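import Literature.Topology.FourManifolds.LickorishTwistExtension
import Literature.Topology.FourManifolds.TubeSurgery
import Literature.Topology.FourManifolds.SmoothEmbeddingComp
import Literature.Topology.FourManifolds.CorkDecompositionSplittingProof
import Literature.Topology.FourManifolds.FramedTubularNbhd
import Literature.Topology.FourManifolds.InverseFunctionTheorem
import HarnessLib

/-!
# Lickorish's surgery realisation of one Dehn twist in a gluing map

Topic `Literature/Topology/FourManifolds`; third file of the proof of leaf **F4** of the
Lickorish–Wallace DAG (`LickorishTwistProfile.lean`, `LickorishTwistExtension.lean`). **Main theorem**
(`isBoundaryGluingWith_twistedEmb_of_dehnTwist`): let `P = M ∪_φ N` be a closed `3`-manifold glued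
from compact `3`-manifolds with boundary (explicit witnesses, `IsBoundaryGluingWith`), `c` a collar of
`∂M`, `τ` a Dehn twist of `∂M` with annulus chart `e`, `0 < d ≤ 1/3`; let `ν = tube c e h hd0 hd` be
the tube around the core circle `jM (c (e (𝕊 1 × {1/2}) × {d}))` in `P`. Then the manifold `P'`
obtained from `P` by **surgery along `ν`** (`Literature.Topology.FourManifolds.TubeNbhd.Surgered`,
`TubeSurgery.lean`: the open gluing of `P ∖ core` and `D̊² × 𝕊 1` along the surgery relation) **is
`M ∪_{φ ∘ τ} N`**, with the explicit pieces `twistedEmb` (the twisted embedding of `M`) and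
`rightEmb = inl ∘ jN`. This is Lickorish, Ann. of Math. 76 (1962), proof of Thm. 2, p. 539: a
`C`-homeomorphism of `∂T₁` is performed "at the expense of cutting a solid torus out of the interior
of `T₁`, and having to sew it back differently" (Fig. 11); Schultens (2014), Lemma 7.3.4.
Everything here is proved.

Construction. The tube is `(u, w) ↦ jM (c (e (u, 1/2 + ε v₀), d (1 + 2 ε v₁)))`,
`v = u · w/√(1 + ‖w‖²)` (the normal disc turning once along the core; `ε = 1/16`), a smooth
embedding `𝕊 1 × ℝ² ↪ P` with open range (its differential has a left inverse, made of the smooth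
inverses of `jM`, `c` and an explicit inverse of the cylinder map; inverse function theorem). The
twisted embedding is `inl ∘ jM ∘ Ψ⁻¹` off the core circle (`Ψ` the twist spread over the collar,
`LickorishTwistExtension.lean`) and `u ↦ inr (0, ū)` on it; the **key formula**
`twistedEmb (tube (u, w)) = inr (u² · w, ū)` (`twistedEmb_tubeM`, from `twistExtensionInv_tubeM`:
`Ψ⁻¹ (tube (u, w)) = tube ((u ŵ) u, (u ŵ)⁻¹ · w)`) shows that it extends smoothly across the core,
where it is the re-gluing partial diffeomorphism `ν (u, w) ↦ inr (u² · w, ū)` after `jM`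
(`TubeNbhd.coreHomeo`). Immersion proofs are compositions with partial diffeomorphisms of the same
model (`comp_openPartialHomeomorph`, `openPartialHomeomorph_comp`) and with `inl` / `inr`
(`SmoothGlueData.isImmersionAtOfComplement_inl_comp`); the seam `twistedEmb m = inl (jN y)` iff
`m = incl z`, `y = incl (φ (τ z))` is the computation `Ψ⁻¹ ∘ incl = incl ∘ τ`.

* §1 `IsBoundaryGluingWith` (explicit-witness `IsBoundaryGluing`) and its API;
* §2 `tubeVec`, `tubeProfile`, `tubeCyl`, `tubeM`, `twistExtensionInv_tubeM`;
* §3 `tubeP`, `injective_mfderiv_tubeP`, `isSmoothEmbedding_tubeP`, `tube : TubeNbhd`;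
* §4 `TubeNbhd.exch`, `TubeNbhd.coreHomeo`;
* §5 `twistedEmb`, `twistedEmb_tubeM`, `isSmoothEmbedding_twistedEmb`, `rightEmb`, cover, seam,
  `isBoundaryGluingWith_twistedEmb(_of_dehnTwist)`.

## References

* W. B. R. Lickorish, Ann. of Math. 76 (1962), proof of Thm. 2 (pp. 538–540, Fig. 11).
  [LickorishAnnals1962]
* J. Schultens, *Introduction to 3-Manifolds* (2014), Lemma 7.3.4. [Schultens2014]
* D. Rolfsen, *Knots and Links* (1976), §9.F (surgery along a solid torus). [Rolfsen1976]
-/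

open scoped Manifold ContDiff Topology
open Set Function Metric

noncomputable section

namespace Literature.Topology.FourManifolds

open LickorishTwist

universe u v

/-- Local notation: `𝔼 n` is the model Euclidean space `EuclideanSpace ℝ (Fin n)`. -/
local notation "𝔼 " n:arg => EuclideanSpace ℝ (Fin n)

/-- Local notation: `𝕊 n` is the unit sphere in `EuclideanSpace ℝ (Fin (n + 1))`. -/
local notation "𝕊 " n:arg => (Metric.sphere (0 : EuclideanSpace ℝ (Fin (n + 1))) 1)

attribute [local instance] fact_finrank_euclideanSpace_succ

/-! ### Gluing along the boundary with explicit witnesses -/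

section With

variable {EM HM EN HN E₀ H₀ E₀' H₀' EP HP : Type*}
  [NormedAddCommGroup EM] [NormedSpace ℝ EM] [TopologicalSpace HM] {IM : ModelWithCorners ℝ EM HM}
  [NormedAddCommGroup EN] [NormedSpace ℝ EN] [TopologicalSpace HN] {IN : ModelWithCorners ℝ EN HN}
  [NormedAddCommGroup E₀] [NormedSpace ℝ E₀] [TopologicalSpace H₀] {I₀ : ModelWithCorners ℝ E₀ H₀}
  [NormedAddCommGroup E₀'] [NormedSpace ℝ E₀'] [TopologicalSpace H₀']
  {I₀' : ModelWithCorners ℝ E₀' H₀'}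
  [NormedAddCommGroup EP] [NormedSpace ℝ EP] [TopologicalSpace HP]
  {M : Type u} [TopologicalSpace M] [ChartedSpace HM M]
  {N : Type u} [TopologicalSpace N] [ChartedSpace HN N]

/-- **Gluing along the boundary, with explicit witnesses**: the body of
`Literature.Topology.FourManifolds.IsBoundaryGluing` "`P = M ∪_φ N`" with the two smooth embeddings
`jM : M ↪ P`, `jN : N ↪ P` exposed (pattern of `Literature.Topology.FourManifolds.IsOpenGluingWith`):
`jM`, `jN` are `C^∞` embeddings whose ranges cover `P`, meeting exactly along `∂M ≡_φ ∂N`.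
Hirsch, *Differential Topology* (1976), §8.2. [folklore] -/
def IsBoundaryGluingWith (bM : BoundaryData IM M I₀) (bN : BoundaryData IN N I₀')
    (φ : bM.carrier → bN.carrier) (IP : ModelWithCorners ℝ EP HP) {P : Type*} [TopologicalSpace P]
    [ChartedSpace HP P] (jM : M → P) (jN : N → P) : Prop :=
  Manifold.IsSmoothEmbedding IM IP ∞ jM ∧ Manifold.IsSmoothEmbedding IN IP ∞ jN ∧
    range jM ∪ range jN = univ ∧ ∀ x y, jM x = jN y ↔ ∃ z, x = bM.incl z ∧ y = bN.incl (φ z)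

variable {bM : BoundaryData IM M I₀} {bN : BoundaryData IN N I₀'} {φ : bM.carrier → bN.carrier}
  {IP : ModelWithCorners ℝ EP HP} {P : Type*} [TopologicalSpace P] [ChartedSpace HP P]

/-- `IsBoundaryGluing` unfolded to explicit witnesses. [folklore] -/
theorem isBoundaryGluing_iff_exists_with :
    IsBoundaryGluing bM bN φ IP P ↔ ∃ (jM : M → P) (jN : N → P), IsBoundaryGluingWith bM bN φ IP jM jN :=
  Iff.rfl

/-- Explicit witnesses give a gluing along the boundary. [folklore] -/
theorem IsBoundaryGluingWith.isBoundaryGluing {jM : M → P} {jN : N → P}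
    (h : IsBoundaryGluingWith bM bN φ IP jM jN) : IsBoundaryGluing bM bN φ IP P :=
  ⟨jM, jN, h⟩

namespace IsBoundaryGluingWith

variable {jM : M → P} {jN : N → P} (h : IsBoundaryGluingWith bM bN φ IP jM jN)
include h

/-- The left piece `jM` of an explicit gluing is a smooth embedding. [folklore] -/
theorem isSmoothEmbedding_left : Manifold.IsSmoothEmbedding IM IP ∞ jM := h.1
/-- The right piece `jN` of an explicit gluing is a smooth embedding. [folklore] -/
theorem isSmoothEmbedding_right : Manifold.IsSmoothEmbedding IN IP ∞ jN := h.2.1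
/-- The two pieces of an explicit gluing cover the glued manifold. [folklore] -/
theorem range_union_range : range jM ∪ range jN = univ := h.2.2.1
/-- The seam relation of an explicit gluing: `jM x = jN y` iff `x = incl z`, `y = incl (φ z)`. [folklore] -/
theorem apply_eq_apply_iff (x : M) (y : N) : jM x = jN y ↔ ∃ z, x = bM.incl z ∧ y = bN.incl (φ z) :=
  h.2.2.2 x y
/-- The left piece of an explicit gluing is injective. [folklore] -/
theorem injective_left : Injective jM := h.1.isEmbedding.injective
/-- The right piece of an explicit gluing is injective. [folklore] -/
theorem injective_right : Injective jN := h.2.1.isEmbedding.injective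
/-- The left piece of an explicit gluing is continuous. [folklore] -/
theorem continuous_left : Continuous jM := h.1.isEmbedding.continuous
/-- The right piece of an explicit gluing is continuous. [folklore] -/
theorem continuous_right : Continuous jN := h.2.1.isEmbedding.continuous

/-- The seam identity `jM (incl z) = jN (incl (φ z))`. [folklore] -/
theorem apply_incl (z : bM.carrier) : jM (bM.incl z) = jN (bN.incl (φ z)) :=
  (h.apply_eq_apply_iff _ _).2 ⟨z, rfl, rfl⟩

/-- A point of `M` whose image meets `jN (N)` is a boundary point. [folklore] -/
theorem mem_range_incl_of_apply_eq {x : M} {y : N} (hxy : jM x = jN y) : x ∈ range bM.incl := by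
  obtain ⟨z, rfl, -⟩ := (h.apply_eq_apply_iff x y).1 hxy
  exact mem_range_self z

/-- An interior point of `M` is not in the image of `N`. [folklore] -/
theorem apply_not_mem_range_right {x : M} (hx : x ∈ IM.interior M) : jM x ∉ range jN := by
  rintro ⟨y, hy⟩
  have h1 := h.mem_range_incl_of_apply_eq hy.symm
  rw [bM.range_incl, ← ModelWithCorners.compl_interior] at h1
  exact h1 hx

/-- Every point of `P` off `jM (M)` is in `jN (N)`. [folklore] -/
theorem mem_range_right_of_not_mem {p : P} (hp : p ∉ range jM) : p ∈ range jN := by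
  have := h.range_union_range ▸ mem_univ p
  exact this.resolve_left hp

end IsBoundaryGluingWith

end With

/-! ### The tube around the core circle -/

namespace LickorishTwist

section Tube

/-- The radial projection is unchanged by a positive scalar. [folklore] -/
theorem radialProjection_pos_smul {n : ℕ} (p : 𝕊 n) {y : 𝔼 (n + 1)} {r : ℝ} (hr : 0 < r) :
    radialProjection p (r • y) = radialProjection p y := by
  by_cases hy : y = 0
  · simp [hy]
  · conv_lhs => rw [← norm_smul_coe_radialProjection p y, smul_smul]
    exact radialProjection_smul p (mul_pos hr (norm_pos_iff.2 hy)) _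

/-- The **tube radius** `ε = 1/16` in profile units. [folklore] -/
def tubeEps : ℝ := 1 / 16

/-- The tube radius `ε = 1/16` is positive. [folklore] -/
theorem tubeEps_pos : 0 < tubeEps := by norm_num [tubeEps]
/-- The tube radius `ε = 1/16` is less than `1/8` (the tube stays in the near-core region of the profile). [folklore] -/
theorem tubeEps_lt : tubeEps < 1 / 8 := by norm_num [tubeEps]

/-- The **fibre vector** `v(u, w) = u · w/√(1 + ‖w‖²) ∈ B(0, 1)` of the tube point over `u` with
fibre coordinate `w`: the normal disc turns once along the core (`u ·`), and the whole plane `ℝ²`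
is squashed into the unit disc. [folklore] -/
def tubeVec (q : (𝕊 1) × (𝔼 2)) : 𝔼 2 := rot q.1 (OpenPartialHomeomorph.univUnitBall q.2)

/-- The squashed fibre coordinate has norm `< 1`. [folklore] -/
theorem norm_univUnitBall_lt (w : 𝔼 2) : ‖(OpenPartialHomeomorph.univUnitBall w : 𝔼 2)‖ < 1 := by
  have h : (OpenPartialHomeomorph.univUnitBall w : 𝔼 2) ∈ OpenPartialHomeomorph.univUnitBall.target :=
    OpenPartialHomeomorph.univUnitBall.map_source
      (by rw [OpenPartialHomeomorph.univUnitBall_source]; exact mem_univ _)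
  rw [OpenPartialHomeomorph.univUnitBall_target, mem_ball_zero_iff] at h
  exact h

/-- The fibre vector has norm `< 1`. [folklore] -/
theorem norm_tubeVec_lt (q : (𝕊 1) × (𝔼 2)) : ‖tubeVec q‖ < 1 := by
  rw [tubeVec, norm_rot]; exact norm_univUnitBall_lt q.2

/-- The fibre vector vanishes exactly on the zero section. [folklore] -/
theorem tubeVec_eq_zero_iff (q : (𝕊 1) × (𝔼 2)) : tubeVec q = 0 ↔ q.2 = 0 := by
  rw [tubeVec, rot_eq_zero_iff]
  constructor
  · intro h
    have := congrArg OpenPartialHomeomorph.univUnitBall.symm h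
    rwa [OpenPartialHomeomorph.univUnitBall.left_inv
        (by rw [OpenPartialHomeomorph.univUnitBall_source]; exact mem_univ _),
      OpenPartialHomeomorph.univUnitBall_symm_apply_zero] at this
  · rintro h; rw [h, OpenPartialHomeomorph.univUnitBall_apply_zero]

/-- The fibre vector vanishes on the zero section. [folklore] -/
@[simp] theorem tubeVec_zero (u : 𝕊 1) : tubeVec (u, 0) = 0 := (tubeVec_eq_zero_iff _).2 rfl

/-- The squash is a positive multiple. [folklore] -/
theorem univUnitBall_eq_smul (w : 𝔼 2) :
    (OpenPartialHomeomorph.univUnitBall w : 𝔼 2) = (Real.sqrt (1 + ‖w‖ ^ 2))⁻¹ • w :=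
  OpenPartialHomeomorph.univUnitBall_apply w

/-- The direction of the fibre vector: `v(u, w)/‖v(u, w)‖ = u · (w/‖w‖)`. [folklore] -/
theorem radialProjection_tubeVec (p : 𝕊 1) {q : (𝕊 1) × (𝔼 2)} (hq : q.2 ≠ 0) :
    radialProjection p (tubeVec q) = circleMul q.1 (radialProjection p q.2) := by
  have hne : (OpenPartialHomeomorph.univUnitBall q.2 : 𝔼 2) ≠ 0 := by
    intro h; exact hq ((tubeVec_eq_zero_iff q).1 (by rw [tubeVec, h, rot_zero]))
  rw [tubeVec, radialProjection_rot p q.1 hne, univUnitBall_eq_smul,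
    radialProjection_pos_smul p (inv_pos.2 (Real.sqrt_pos.2 (by positivity)))]

/-- The **profile coordinates** `(1/2 + ε v₀, 1/2 + ε v₁)` of the tube point. [folklore] -/
def tubeProfile (q : (𝕊 1) × (𝔼 2)) : ℝ × ℝ := (1 / 2 + tubeEps * tubeVec q 0, 1 / 2 + tubeEps * tubeVec q 1)

/-- Seen from the puncture, the profile point is `ε v`. [folklore] -/
theorem vec_tubeProfile (q : (𝕊 1) × (𝔼 2)) : vec (tubeProfile q) = tubeEps • tubeVec q := by
  ext i; fin_cases i <;> simp [tubeProfile, vec]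

/-- The profile point lies within `1/16 < 1/8` of the puncture. [folklore] -/
theorem norm_vec_tubeProfile_lt (q : (𝕊 1) × (𝔼 2)) : ‖vec (tubeProfile q)‖ < 1 / 8 := by
  rw [vec_tubeProfile, norm_smul, Real.norm_of_nonneg tubeEps_pos.le]
  have := norm_tubeVec_lt q
  have := tubeEps_lt
  have := tubeEps_pos
  nlinarith

/-- The profile point is the puncture exactly on the zero section. [folklore] -/
theorem tubeProfile_eq_punct_iff (q : (𝕊 1) × (𝔼 2)) : tubeProfile q = punct ↔ q.2 = 0 := by
  rw [← zc_eq_zero_iff, ← vec_eq_zero_iff, vec_tubeProfile, smul_eq_zero, tubeVec_eq_zero_iff]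
  simp [tubeEps_pos.ne']

/-- The direction of the profile point from the puncture is `u · (w/‖w‖)`. [folklore] -/
theorem dir_tubeProfile {q : (𝕊 1) × (𝔼 2)} (hq : q.2 ≠ 0) :
    dir (tubeProfile q) = circleMul q.1 (radialProjection (spherePt 1) q.2) := by
  rw [dir, vec_tubeProfile, radialProjection_pos_smul _ tubeEps_pos, radialProjection_tubeVec _ hq]

/-- Coordinate bounds of the fibre vector. [folklore] -/
theorem abs_tubeVec_apply_lt (q : (𝕊 1) × (𝔼 2)) (i : Fin 2) : |tubeVec q i| < 1 := by
  have h : |tubeVec q i| ≤ ‖tubeVec q‖ := by simpa using PiLp.norm_apply_le (tubeVec q) i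
  exact h.trans_lt (norm_tubeVec_lt q)

/-- The across coordinate of the profile point lies in `(7/16, 9/16)`. [folklore] -/
theorem tubeProfile_fst_mem (q : (𝕊 1) × (𝔼 2)) : (tubeProfile q).1 ∈ Ioo (7 / 16 : ℝ) (9 / 16) := by
  have h := abs_lt.1 (abs_tubeVec_apply_lt q 0)
  simp only [tubeProfile, tubeEps, mem_Ioo]
  constructor <;> nlinarith [h.1, h.2]

/-- The depth coordinate of the profile point lies in `(7/16, 9/16)`. [folklore] -/
theorem tubeProfile_snd_mem (q : (𝕊 1) × (𝔼 2)) : (tubeProfile q).2 ∈ Ioo (7 / 16 : ℝ) (9 / 16) := by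
  have h := abs_lt.1 (abs_tubeVec_apply_lt q 1)
  simp only [tubeProfile, tubeEps, mem_Ioo]
  constructor <;> nlinarith [h.1, h.2]

/-- `tubeVec` is `C^∞`. [folklore] -/
theorem contMDiff_tubeVec : ContMDiff ((𝓡 1).prod 𝓘(ℝ, 𝔼 2)) 𝓘(ℝ, 𝔼 2) ∞ tubeVec :=
  contMDiff_fst.rot (OpenPartialHomeomorph.contDiff_univUnitBall.comp_contMDiff contMDiff_snd)

/-- `tubeProfile` is `C^∞`. [folklore] -/
theorem contMDiff_tubeProfile : ContMDiff ((𝓡 1).prod 𝓘(ℝ, 𝔼 2)) 𝓘(ℝ, ℝ × ℝ) ∞ tubeProfile := by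
  have h : ∀ i : Fin 2, ContMDiff ((𝓡 1).prod 𝓘(ℝ, 𝔼 2)) 𝓘(ℝ, ℝ) ∞ fun q ↦ tubeVec q i := fun i ↦
    ((EuclideanSpace.proj i).contDiff.comp_contMDiff contMDiff_tubeVec)
  exact ((contMDiff_const.add (contMDiff_const.mul (h 0))).prodMk_space
    (contMDiff_const.add (contMDiff_const.mul (h 1))))

variable {M : Type u} [TopologicalSpace M] [ChartedSpace (EuclideanHalfSpace 3) M]
  {b : BoundaryData (𝓡∂ 3) M (𝓡 2)} (c : b.Collar) (e : AnnulusChart (𝓡 2) b.carrier) (d : ℝ)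

/-- The **cylinder point of the tube**: `(e (u, 1/2 + ε v₀), 2d (1/2 + ε v₁))` in `∂M × [0, 1]`
(height clamped; for `0 ≤ d ≤ 1/3` no clamping occurs). [folklore] -/
def tubeCyl (q : (𝕊 1) × (𝔼 2)) : b.carrier × Set.Icc (0 : ℝ) 1 :=
  (e (q.1, (tubeProfile q).1), Set.projIcc 0 1 zero_le_one (2 * d * (tubeProfile q).2))

/-- **The tube in `M`** around the core circle `c (e (𝕊 1 × {1/2}) × {d})`:
`(u, w) ↦ c (e (u, 1/2 + ε v₀), 2d (1/2 + ε v₁))`, `v = u · w/√(1 + ‖w‖²)`. [folklore] -/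
def tubeM (q : (𝕊 1) × (𝔼 2)) : M := c (tubeCyl e d q)

variable {d}

/-- The clamped height `2d (1/2 + ε v₁)` is not clamped (`0 ≤ d ≤ 1/3`). [folklore] -/
theorem coe_projIcc_tube (hd0 : 0 ≤ d) (hd : d ≤ 1 / 3) (q : (𝕊 1) × (𝔼 2)) :
    ((Set.projIcc (0 : ℝ) 1 zero_le_one (2 * d * (tubeProfile q).2) : Set.Icc (0 : ℝ) 1) : ℝ) =
      2 * d * (tubeProfile q).2 := by
  have h := tubeProfile_snd_mem q
  rw [Set.projIcc_of_mem]
  constructor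
  · exact mul_nonneg (by linarith) (by linarith [h.1])
  · nlinarith [h.2]

/-- The height of the tube point is `2d (1/2 + ε v₁) ∈ (7d/8, 9d/8)` (`0 ≤ d ≤ 1/3`). [folklore] -/
theorem coe_tubeCyl_snd (hd0 : 0 ≤ d) (hd : d ≤ 1 / 3) (q : (𝕊 1) × (𝔼 2)) :
    ((tubeCyl e d q).2 : ℝ) = 2 * d * (tubeProfile q).2 :=
  coe_projIcc_tube hd0 hd q

/-- The height of the tube point is at most `3d/8 · 3 = 9d/8 ≤ 3/8`. [folklore] -/
theorem coe_tubeCyl_snd_lt (hd0 : 0 < d) (hd : d ≤ 1 / 3) (q : (𝕊 1) × (𝔼 2)) :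
    ((tubeCyl e d q).2 : ℝ) < 3 * d / 2 := by
  rw [coe_tubeCyl_snd e hd0.le hd]
  nlinarith [(tubeProfile_snd_mem q).2]

/-- The profile depth of the tube point: height `/ (2d)`. [folklore] -/
theorem coe_tubeCyl_snd_div (hd0 : 0 < d) (hd : d ≤ 1 / 3) (q : (𝕊 1) × (𝔼 2)) :
    ((tubeCyl e d q).2 : ℝ) / (2 * d) = (tubeProfile q).2 := by
  rw [coe_tubeCyl_snd e hd0.le hd]; field_simp

/-- The surface coordinate of the cylinder point of the tube: `e (u, 1/2 + ε v₀)`. [folklore] -/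
@[simp] theorem tubeCyl_fst (q : (𝕊 1) × (𝔼 2)) : (tubeCyl e d q).1 = e (q.1, (tubeProfile q).1) := rfl

/-- The zero section of the tube is the core of the cylinder slide. [folklore] -/
theorem tubeCyl_zero (u : 𝕊 1) : tubeCyl e d (u, 0) = (e (u, 1 / 2), Set.projIcc 0 1 zero_le_one d) := by
  simp only [tubeCyl, tubeProfile, tubeVec_zero, PiLp.zero_apply, mul_zero, add_zero]
  congr 2; ring

/-- **The zero section of the tube is the core circle.** [folklore] -/
theorem tubeM_zero (u : 𝕊 1) : tubeM c e d (u, 0) = c (e (u, 1 / 2), Set.projIcc 0 1 zero_le_one d) := by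
  rw [tubeM, tubeCyl_zero]

/-- The zero section of the tube is the core circle of the twist. [folklore] -/
theorem tubeM_zero_mem_twistCore (u : 𝕊 1) : tubeM c e d (u, 0) ∈ c.twistCore e d :=
  ⟨u, (tubeM_zero c e u).symm⟩

/-- **A tube point lies on the core circle iff it is on the zero section** (`0 < d ≤ 1/3`). [folklore] -/
theorem tubeM_mem_twistCore_iff (hd0 : 0 < d) (hd : d ≤ 1 / 3) (q : (𝕊 1) × (𝔼 2)) :
    tubeM c e d q ∈ c.twistCore e d ↔ q.2 = 0 := by
  rw [tubeM, c.apply_mem_twistCore_iff e hd0 (by linarith), tubeCyl, e.mk_apply_mem_slabCore_iff hd0,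
    coe_projIcc_tube hd0.le hd, ← tubeProfile_eq_punct_iff, punct, Prod.ext_iff]
  simp only
  constructor
  · rintro ⟨h1, h2⟩
    refine ⟨h1, mul_left_cancel₀ (show (2 * d : ℝ) ≠ 0 by positivity) ?_⟩
    rw [h2]; ring
  · rintro ⟨h1, h2⟩
    exact ⟨h1, by rw [h2]; ring⟩

/-- **The inverse twist on the tube** (`0 < d ≤ 1/3`, off the zero section): with `ŵ = w/‖w‖`,
`Ψ⁻¹ (tube (u, w)) = tube ((u ŵ) u, (u ŵ)⁻¹ · w)` — the fibre direction is absorbed into the core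
coordinate. This is the computation behind Lickorish's Fig. 11. [folklore] -/
theorem twistExtensionInv_tubeM (hd0 : 0 < d) (hd : d ≤ 1 / 3) {q : (𝕊 1) × (𝔼 2)} (hq : q.2 ≠ 0) :
    c.twistExtensionInv e d (tubeM c e d q) =
      tubeM c e d (circleMul (circleMul q.1 (radialProjection (spherePt 1) q.2)) q.1,
        rot (conjCircle (circleMul q.1 (radialProjection (spherePt 1) q.2))) q.2) := by
  set ŵ := radialProjection (spherePt 1) q.2 with hŵ
  -- the new tube point has the same fibre vector, hence the same profile and height
  have key : circleMul (circleMul (circleMul q.1 ŵ) q.1) (conjCircle (circleMul q.1 ŵ)) = q.1 := by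
    rw [circleMul_comm (circleMul q.1 ŵ) q.1, circleMul_assoc, circleMul_self_conjCircle,
      circleMul_circlePoint_zero_right]
  have hvec : tubeVec (circleMul (circleMul q.1 ŵ) q.1, rot (conjCircle (circleMul q.1 ŵ)) q.2) =
      tubeVec q := by
    simp only [tubeVec]
    rw [univUnitBall_rot, rot_rot, key]
  have hprof : tubeProfile (circleMul (circleMul q.1 ŵ) q.1, rot (conjCircle (circleMul q.1 ŵ)) q.2) =
      tubeProfile q := by
    simp only [tubeProfile, hvec]
  rw [tubeM, tubeM, c.twistExtensionInv_apply]
  congr 1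
  ext1
  · rw [AnnulusChart.slabUnslide_fst, tubeCyl_fst, tubeCyl_fst, coe_tubeCyl_snd_div e hd0 hd,
      AnnulusChart.untwistAt_apply, hprof]
    congr 1
    rw [show ((q.1, (tubeProfile q).1) : (𝕊 1) × ℝ) = (q.1, (tubeProfile q).1) from rfl,
      untwistLevel_of_norm_lt (a := (q.1, (tubeProfile q).1)) (s := (tubeProfile q).2)
        (by exact norm_vec_tubeProfile_lt q)]
    simp only [Prod.mk.injEq, and_true]
    rw [show (((tubeProfile q).1, (tubeProfile q).2) : ℝ × ℝ) = tubeProfile q from rfl, dir_tubeProfile hq]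
  · simp only [AnnulusChart.slabUnslide_snd, tubeCyl, hprof]

end Tube

/-! ### The tube is a smooth embedding into the glued manifold -/

section Emb

variable {M : Type u} [TopologicalSpace M] [ChartedSpace (EuclideanHalfSpace 3) M]
  {b : BoundaryData (𝓡∂ 3) M (𝓡 2)} (c : b.Collar) (e : AnnulusChart (𝓡 2) b.carrier) {d : ℝ}

/-- The cylinder point of the tube depends smoothly on `(u, w)` (`0 ≤ d ≤ 1/3`). [folklore] -/
theorem contMDiff_tubeCyl (hd0 : 0 ≤ d) (hd : d ≤ 1 / 3) :
    ContMDiff ((𝓡 1).prod 𝓘(ℝ, 𝔼 2)) ((𝓡 2).prod (𝓡∂ 1)) ∞ (tubeCyl e d) := by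
  have h1 : ContMDiff ((𝓡 1).prod 𝓘(ℝ, 𝔼 2)) ((𝓡 1).prod 𝓘(ℝ, ℝ)) ∞
      fun q : (𝕊 1) × (𝔼 2) ↦ (q.1, (tubeProfile q).1) :=
    contMDiff_fst.prodMk (contDiff_fst.comp_contMDiff contMDiff_tubeProfile)
  have h2 : ContMDiff ((𝓡 1).prod 𝓘(ℝ, 𝔼 2)) 𝓘(ℝ, ℝ) ∞
      fun q : (𝕊 1) × (𝔼 2) ↦ 2 * d * (tubeProfile q).2 :=
    contMDiff_const.mul (contDiff_snd.comp_contMDiff contMDiff_tubeProfile)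
  have h3 : ContMDiff ((𝓡 1).prod 𝓘(ℝ, 𝔼 2)) (𝓡∂ 1) ∞
      fun q : (𝕊 1) × (𝔼 2) ↦ Set.projIcc (0 : ℝ) 1 zero_le_one (2 * d * (tubeProfile q).2) := by
    refine contMDiffOn_projIcc.comp_contMDiff h2 fun q ↦ ?_
    have h := tubeProfile_snd_mem q
    exact ⟨mul_nonneg (by linarith) (by linarith [h.1]), by nlinarith [h.2]⟩
  exact (e.contMDiff.comp h1).prodMk h3

/-- The tube in `M` is `C^∞` (`0 ≤ d ≤ 1/3`). [folklore] -/
theorem contMDiff_tubeM (hd0 : 0 ≤ d) (hd : d ≤ 1 / 3) :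
    ContMDiff ((𝓡 1).prod 𝓘(ℝ, 𝔼 2)) (𝓡∂ 3) ∞ (tubeM c e d) :=
  c.isSmoothEmbedding.contMDiff.comp (contMDiff_tubeCyl e hd0 hd)

/-- **A left inverse of the cylinder map of the tube**: from `(e (u, r), s)` recover
`v = ((r - 1/2)/ε, (s/(2d) - 1/2)/ε)` and `w = (u⁻¹ · v)` unsquashed. [folklore] -/
def tubeCylInv (x : b.carrier × Set.Icc (0 : ℝ) 1) : (𝕊 1) × (𝔼 2) :=
  ((e.inv x.1).1, OpenPartialHomeomorph.univUnitBall.symm (rot (conjCircle (e.inv x.1).1)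
    (WithLp.toLp 2 ![((e.inv x.1).2 - 1 / 2) / tubeEps, ((x.2 : ℝ) / (2 * d) - 1 / 2) / tubeEps])))

/-- The recovered fibre vector of a tube point is `v(u, w)`. [folklore] -/
theorem tubeCylInv_aux (hd0 : 0 < d) (hd : d ≤ 1 / 3) (q : (𝕊 1) × (𝔼 2)) :
    (WithLp.toLp 2 ![((e.inv (tubeCyl e d q).1).2 - 1 / 2) / tubeEps,
      (((tubeCyl e d q).2 : ℝ) / (2 * d) - 1 / 2) / tubeEps] : 𝔼 2) = tubeVec q := by
  rw [tubeCyl_fst, e.inv_apply, coe_tubeCyl_snd_div e hd0 hd]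
  ext i; fin_cases i <;> simp [tubeProfile, tubeEps_pos.ne']

/-- `tubeCylInv` is a left inverse of `tubeCyl` (`0 < d ≤ 1/3`). [folklore] -/
theorem tubeCylInv_tubeCyl (hd0 : 0 < d) (hd : d ≤ 1 / 3) (q : (𝕊 1) × (𝔼 2)) :
    tubeCylInv e (d := d) (tubeCyl e d q) = q := by
  rw [tubeCylInv, tubeCylInv_aux e hd0 hd q]
  ext1
  · simp [tubeCyl]
  · simp only [tubeCyl_fst, e.inv_apply, tubeVec, rot_conjCircle_rot]
    exact OpenPartialHomeomorph.univUnitBall.left_inv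
      (by rw [OpenPartialHomeomorph.univUnitBall_source]; exact mem_univ _)

/-- The cylinder map of the tube is injective. [folklore] -/
theorem tubeCyl_injective (hd0 : 0 < d) (hd : d ≤ 1 / 3) : Injective (tubeCyl e d) :=
  LeftInverse.injective (tubeCylInv_tubeCyl e hd0 hd)

/-- The tube in `M` is injective. [folklore] -/
theorem tubeM_injective (hd0 : 0 < d) (hd : d ≤ 1 / 3) : Injective (tubeM c e d) :=
  c.injective.comp (tubeCyl_injective e hd0 hd)

/-- **The left inverse of the cylinder map is smooth at tube points** (`0 < d ≤ 1/3`). [folklore] -/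
theorem contMDiffAt_tubeCylInv (hd0 : 0 < d) (hd : d ≤ 1 / 3) (q : (𝕊 1) × (𝔼 2)) :
    ContMDiffAt ((𝓡 2).prod (𝓡∂ 1)) ((𝓡 1).prod 𝓘(ℝ, 𝔼 2)) ∞ (tubeCylInv e (d := d)) (tubeCyl e d q) := by
  have hopen : IsOpen ((range e) ×ˢ (univ : Set (Set.Icc (0 : ℝ) 1))) := e.isOpen_range.prod isOpen_univ
  have hmem : tubeCyl e d q ∈ (range e) ×ˢ (univ : Set (Set.Icc (0 : ℝ) 1)) := ⟨mem_range_self _, mem_univ _⟩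
  -- the annulus coordinates
  have hinv : ContMDiffAt ((𝓡 2).prod (𝓡∂ 1)) ((𝓡 1).prod 𝓘(ℝ, ℝ)) ∞
      (fun x : b.carrier × Set.Icc (0 : ℝ) 1 ↦ e.inv x.1) (tubeCyl e d q) :=
    (e.contMDiffOn_inv.contMDiffAt (e.isOpen_range.mem_nhds hmem.1)).comp _ contMDiffAt_fst
  have hu : ContMDiffAt ((𝓡 2).prod (𝓡∂ 1)) (𝓡 1) ∞
      (fun x : b.carrier × Set.Icc (0 : ℝ) 1 ↦ (e.inv x.1).1) (tubeCyl e d q) := contMDiffAt_fst.comp _ hinv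
  have hr : ContMDiffAt ((𝓡 2).prod (𝓡∂ 1)) 𝓘(ℝ, ℝ) ∞
      (fun x : b.carrier × Set.Icc (0 : ℝ) 1 ↦ (e.inv x.1).2) (tubeCyl e d q) := contMDiffAt_snd.comp _ hinv
  have hs : ContMDiffAt ((𝓡 2).prod (𝓡∂ 1)) 𝓘(ℝ, ℝ) ∞
      (fun x : b.carrier × Set.Icc (0 : ℝ) 1 ↦ (x.2 : ℝ)) (tubeCyl e d q) :=
    (contMDiff_subtype_coe_Icc.comp contMDiff_snd).contMDiffAt
  -- the recovered fibre vector
  have hv : ContMDiffAt ((𝓡 2).prod (𝓡∂ 1)) 𝓘(ℝ, 𝔼 2) ∞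
      (fun x : b.carrier × Set.Icc (0 : ℝ) 1 ↦ (WithLp.toLp 2
        ![((e.inv x.1).2 - 1 / 2) / tubeEps, ((x.2 : ℝ) / (2 * d) - 1 / 2) / tubeEps] : 𝔼 2))
      (tubeCyl e d q) := by
    have h : ContMDiffAt ((𝓡 2).prod (𝓡∂ 1)) 𝓘(ℝ, Fin 2 → ℝ) ∞
        (fun x : b.carrier × Set.Icc (0 : ℝ) 1 ↦
          ![((e.inv x.1).2 - 1 / 2) / tubeEps, ((x.2 : ℝ) / (2 * d) - 1 / 2) / tubeEps]) (tubeCyl e d q) := by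
      rw [contMDiffAt_pi_space]
      intro i
      fin_cases i
      · exact ((hr.sub contMDiffAt_const).div_const _)
      · exact (((hs.div_const _).sub contMDiffAt_const).div_const _)
    exact (PiLp.contDiff_toLp (p := 2)).contDiffAt.comp_contMDiffAt h
  have hrot : ContMDiffAt ((𝓡 2).prod (𝓡∂ 1)) 𝓘(ℝ, 𝔼 2) ∞
      (fun x : b.carrier × Set.Icc (0 : ℝ) 1 ↦ rot (conjCircle (e.inv x.1).1) (WithLp.toLp 2
        ![((e.inv x.1).2 - 1 / 2) / tubeEps, ((x.2 : ℝ) / (2 * d) - 1 / 2) / tubeEps] : 𝔼 2))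
      (tubeCyl e d q) :=
    contMDiff_rot.contMDiffAt.comp _ ((contMDiff_conjCircle.contMDiffAt.comp _ hu).prodMk hv)
  -- at the tube point the rotated vector is the squashed fibre coordinate, inside the unit ball
  have hball : rot (conjCircle (e.inv (tubeCyl e d q).1).1) (WithLp.toLp 2
      ![((e.inv (tubeCyl e d q).1).2 - 1 / 2) / tubeEps,
        (((tubeCyl e d q).2 : ℝ) / (2 * d) - 1 / 2) / tubeEps] : 𝔼 2) ∈ ball (0 : 𝔼 2) 1 := by
    rw [tubeCylInv_aux e hd0 hd q, tubeCyl_fst, e.inv_apply, tubeVec, rot_conjCircle_rot, mem_ball_zero_iff]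
    exact norm_univUnitBall_lt q.2
  have hsymm : ContMDiffAt ((𝓡 2).prod (𝓡∂ 1)) 𝓘(ℝ, 𝔼 2) ∞
      (fun x : b.carrier × Set.Icc (0 : ℝ) 1 ↦ OpenPartialHomeomorph.univUnitBall.symm
        (rot (conjCircle (e.inv x.1).1) (WithLp.toLp 2
          ![((e.inv x.1).2 - 1 / 2) / tubeEps, ((x.2 : ℝ) / (2 * d) - 1 / 2) / tubeEps] : 𝔼 2)))
      (tubeCyl e d q) :=
    (OpenPartialHomeomorph.contDiffOn_univUnitBall_symm.contDiffAt
      (isOpen_ball.mem_nhds hball)).contMDiffAt.comp (tubeCyl e d q) hrot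
  exact hu.prodMk hsymm

/-- Tube points lie in the interior of `M` (their height `2d(1/2 + ε v₁)` is positive). [folklore] -/
theorem tubeM_mem_interior (hd0 : 0 < d) (hd : d ≤ 1 / 3) (q : (𝕊 1) × (𝔼 2)) :
    tubeM c e d q ∈ (𝓡∂ 3).interior M := by
  apply c.apply_mem_interior
  show (⊥ : Set.Icc (0 : ℝ) 1) < (tubeCyl e d q).2
  rw [← Subtype.coe_lt_coe, coe_tubeCyl_snd e hd0.le hd]
  have h := (tubeProfile_snd_mem q).1
  show (0 : ℝ) < 2 * d * (tubeProfile q).2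
  positivity

/-- The range of the collar is a neighbourhood of every collar point below the top. [folklore] -/
theorem _root_.Literature.Topology.FourManifolds.BoundaryData.Collar.range_mem_nhds
    {q : b.carrier × Set.Icc (0 : ℝ) 1} (hq : (q.2 : ℝ) < 1) : range c ∈ 𝓝 (c q) := by
  rw [← image_univ]; exact c.image_mem_nhds hq Filter.univ_mem

variable {N : Type u} [TopologicalSpace N] [ChartedSpace (EuclideanHalfSpace 3) N]
  {bN : BoundaryData (𝓡∂ 3) N (𝓡 2)} {φ : b.carrier → bN.carrier}
  {P : Type v} [TopologicalSpace P] [ChartedSpace (𝔼 3) P]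
  {jM : M → P} {jN : N → P}

/-- **The range of `jM` is a neighbourhood of the image of every interior point** (it contains
the open complement of the compact `jN (N)`). [folklore] -/
theorem _root_.Literature.Topology.FourManifolds.IsBoundaryGluingWith.range_left_mem_nhds
    [CompactSpace N] [T2Space P]
    (h : IsBoundaryGluingWith b bN φ (𝓡 3) jM jN) {x : M} (hx : x ∈ (𝓡∂ 3).interior M) :
    range jM ∈ 𝓝 (jM x) := by
  have hclosed : IsClosed (range jN) := (isCompact_range h.continuous_right).isClosed
  refine Filter.mem_of_superset (hclosed.isOpen_compl.mem_nhds (h.apply_not_mem_range_right hx)) ?_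
  intro p hp
  exact (h.range_union_range ▸ mem_univ p).resolve_right hp

variable (jM) in
/-- **The tube in the glued manifold** `P ⊇ jM (M)`: `jM ∘ tubeM`. [folklore] -/
def tubeP (d : ℝ) (q : (𝕊 1) × (𝔼 2)) : P := jM (tubeM c e d q)

omit [TopologicalSpace P] [ChartedSpace (𝔼 3) P] in
/-- The tube in `P` is `jM` of the tube in `M`. [folklore] -/
theorem tubeP_apply (q : (𝕊 1) × (𝔼 2)) : tubeP c e jM d q = jM (tubeM c e d q) := rfl

/-- The tube in `P` is `C^∞` (`0 ≤ d ≤ 1/3`). [folklore] -/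
theorem contMDiff_tubeP (hjM : ContMDiff (𝓡∂ 3) (𝓡 3) ∞ jM) (hd0 : 0 ≤ d) (hd : d ≤ 1 / 3) :
    ContMDiff ((𝓡 1).prod 𝓘(ℝ, 𝔼 2)) (𝓡 3) ∞ (tubeP c e jM d) :=
  hjM.comp (contMDiff_tubeM c e hd0 hd)

omit [TopologicalSpace P] [ChartedSpace (𝔼 3) P] in
/-- The tube in `P` is injective. [folklore] -/
theorem tubeP_injective (hjM : Injective jM) (hd0 : 0 < d) (hd : d ≤ 1 / 3) : Injective (tubeP c e jM d) :=
  hjM.comp (tubeM_injective c e hd0 hd)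

variable [IsManifold (𝓡 3) ∞ P] [CompactSpace N] [T2Space P]

omit [IsManifold (𝓡 3) ∞ P] in
/-- **The differential of the tube is injective**: the tube has a left inverse
`tubeCylInv ∘ c⁻¹ ∘ jM⁻¹` which is `C^∞` at the image point (inverses of smooth embeddings are
smooth on their ranges, which are neighbourhoods here), so `d(tube)` has a left inverse. [folklore] -/
theorem injective_mfderiv_tubeP (h : IsBoundaryGluingWith b bN φ (𝓡 3) jM jN) (hd0 : 0 < d)
    (hd : d ≤ 1 / 3) (q : (𝕊 1) × (𝔼 2)) :
    Injective (mfderiv ((𝓡 1).prod 𝓘(ℝ, 𝔼 2)) (𝓡 3) (tubeP c e jM d) q) := by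
  haveI : Nonempty M := ⟨tubeM c e d q⟩
  haveI : Nonempty (b.carrier × Set.Icc (0 : ℝ) 1) := ⟨tubeCyl e d q⟩
  set jMinv : P → M := Function.invFun jM
  set cinv : M → b.carrier × Set.Icc (0 : ℝ) 1 := Function.invFun c
  have hjMinv : LeftInverse jMinv jM := Function.leftInverse_invFun h.injective_left
  have hcinv : LeftInverse cinv c := Function.leftInverse_invFun c.injective
  set Λ : P → (𝕊 1) × (𝔼 2) := fun p ↦ tubeCylInv e (d := d) (cinv (jMinv p))
  have hΛ : ∀ q', Λ (tubeP c e jM d q') = q' := fun q' ↦ by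
    simp only [Λ, tubeP, tubeM, hjMinv _, hcinv _, tubeCylInv_tubeCyl e hd0 hd]
  -- smoothness of the left inverse at the image point
  have h1 : ContMDiffAt (𝓡 3) (𝓡∂ 3) ∞ jMinv (tubeP c e jM d q) :=
    (contMDiffOn_leftInverse_of_isImmersion h.isSmoothEmbedding_left.isImmersion
      h.isSmoothEmbedding_left.isEmbedding hjMinv).contMDiffAt
      (h.range_left_mem_nhds (tubeM_mem_interior c e hd0 hd q))
  have h2 : ContMDiffAt (𝓡∂ 3) ((𝓡 2).prod (𝓡∂ 1)) ∞ cinv (tubeM c e d q) :=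
    (contMDiffOn_leftInverse_of_isImmersion c.isSmoothEmbedding.isImmersion
      c.isSmoothEmbedding.isEmbedding hcinv).contMDiffAt
      (c.range_mem_nhds (by have := coe_tubeCyl_snd_lt e hd0 hd q; linarith))
  have h3 := contMDiffAt_tubeCylInv e hd0 hd q
  have hΛs : ContMDiffAt (𝓡 3) ((𝓡 1).prod 𝓘(ℝ, 𝔼 2)) ∞ Λ (tubeP c e jM d q) := by
    refine ContMDiffAt.comp_of_eq (h3.comp_of_eq h2 (hcinv _)) h1 ?_
    exact hjMinv _
  have hν : ContMDiffAt ((𝓡 1).prod 𝓘(ℝ, 𝔼 2)) (𝓡 3) ∞ (tubeP c e jM d) q :=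
    (contMDiff_tubeP c e h.isSmoothEmbedding_left.contMDiff hd0.le hd).contMDiffAt
  have hcomp := mfderiv_comp q (hΛs.mdifferentiableAt (by simp)) (hν.mdifferentiableAt (by simp))
  have hid : Λ ∘ tubeP c e jM d = id := funext hΛ
  rw [hid, mfderiv_id] at hcomp
  have key : ∀ v, (mfderiv (𝓡 3) ((𝓡 1).prod 𝓘(ℝ, 𝔼 2)) Λ (tubeP c e jM d q))
      ((mfderiv ((𝓡 1).prod 𝓘(ℝ, 𝔼 2)) (𝓡 3) (tubeP c e jM d) q) v) = v := fun v ↦ by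
    exact (ContinuousLinearMap.ext_iff.1 hcomp v).symm
  exact Function.LeftInverse.injective key

/-- The model vector spaces of the tube and of `P` have the same dimension `3`. [folklore] -/
theorem finrank_tube_model : Module.finrank ℝ (EuclideanSpace ℝ (Fin 1) × 𝔼 2) = Module.finrank ℝ (𝔼 3) := by
  simp

/-- **The tube is a local diffeomorphism** (inverse function theorem). [folklore] -/
theorem isLocalDiffeomorph_tubeP (h : IsBoundaryGluingWith b bN φ (𝓡 3) jM jN) (hd0 : 0 < d)
    (hd : d ≤ 1 / 3) : IsLocalDiffeomorph ((𝓡 1).prod 𝓘(ℝ, 𝔼 2)) (𝓡 3) ∞ (tubeP c e jM d) := by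
  intro q
  have hinj := injective_mfderiv_tubeP c e h hd0 hd q
  set A : (EuclideanSpace ℝ (Fin 1) × 𝔼 2) →L[ℝ] 𝔼 3 := mfderiv ((𝓡 1).prod 𝓘(ℝ, 𝔼 2)) (𝓡 3) (tubeP c e jM d) q
  have hinjA : Injective A.toLinearMap := hinj
  let L : (EuclideanSpace ℝ (Fin 1) × 𝔼 2) ≃L[ℝ] 𝔼 3 :=
    (A.toLinearMap.linearEquivOfInjective hinjA finrank_tube_model).toContinuousLinearEquiv
  refine isLocalDiffeomorphAt_of_mfderiv isOpen_univ (mem_univ q)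
    (contMDiff_tubeP c e h.isSmoothEmbedding_left.contMDiff hd0.le hd).contMDiffOn (by simp) L ?_
  ext1 v
  rfl

/-- **The tube is a smooth embedding of `𝕊 1 × ℝ²` into `P`.** [folklore] -/
theorem isSmoothEmbedding_tubeP (h : IsBoundaryGluingWith b bN φ (𝓡 3) jM jN) (hd0 : 0 < d)
    (hd : d ≤ 1 / 3) : Manifold.IsSmoothEmbedding ((𝓡 1).prod 𝓘(ℝ, 𝔼 2)) (𝓡 3) ∞ (tubeP c e jM d) :=
  isSmoothEmbedding_of_isLocalDiffeomorph (isLocalDiffeomorph_tubeP c e h hd0 hd)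
    (tubeP_injective c e h.injective_left hd0 hd) (ContinuousLinearEquiv.ofFinrankEq finrank_tube_model)

/-- The tube has open range. [folklore] -/
theorem isOpen_range_tubeP (h : IsBoundaryGluingWith b bN φ (𝓡 3) jM jN) (hd0 : 0 < d)
    (hd : d ≤ 1 / 3) : IsOpen (range (tubeP c e jM d)) :=
  (isLocalDiffeomorph_tubeP c e h hd0 hd).isOpen_range

/-- **The tube around the image `jM (core circle)` of the core circle in `P`**, as a
`Literature.Topology.FourManifolds.TubeNbhd` (the datum of a tube surgery, `TubeSurgery.lean`).
[cite: LickorishAnnals1962, proof of Thm. 2 (p. 539)] -/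
def tube (h : IsBoundaryGluingWith b bN φ (𝓡 3) jM jN) (hd0 : 0 < d) (hd : d ≤ 1 / 3) :
    TubeNbhd (𝓡 3) (fun u : 𝕊 1 ↦ jM (tubeM c e d (u, 0))) where
  toFun := tubeP c e jM d
  isSmoothEmbedding := isSmoothEmbedding_tubeP c e h hd0 hd
  isOpen_range := isOpen_range_tubeP c e h hd0 hd
  apply_zero _ := rfl

/-- The underlying map of the tube neighbourhood `tube` is `tubeP`. [folklore] -/
@[simp] theorem tube_toFun (h : IsBoundaryGluingWith b bN φ (𝓡 3) jM jN) (hd0 : 0 < d) (hd : d ≤ 1 / 3) :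
    (tube c e h hd0 hd).toFun = tubeP c e jM d := rfl

end Emb

end LickorishTwist

/-! ### The re-gluing diffeomorphism near the core: `ν (u, w) ↦ inr (u² · w, ū)` -/

section CoreHomeo

variable {X : Type u} [TopologicalSpace X] [T2Space X] [ChartedSpace (𝔼 3) X] [IsManifold (𝓡 3) ∞ X]
  {cc : 𝕊 1 → X} (ν : TubeNbhd (𝓡 3) cc)

namespace TubeNbhd

open Classical in
/-- **The fibre-to-core exchange** `G (u, w) = (u² · w, ū) ∈ D̊² × 𝕊 1` on the unit disc bundle
(junk off it): where the twisted embedding sends the tube point `(u, w)` in the new solid torus. [folklore] -/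
def exch (q : (𝕊 1) × (𝔼 2)) : ↥solidTorus :=
  if hq : ‖q.2‖ < 1 then ⟨(rot (circleMul q.1 q.1) q.2, conjCircle q.1), by rwa [mem_solidTorus_iff, norm_rot]⟩
  else basePtB

/-- The inverse exchange `(p, v) ↦ (v̄, v² · p)`. [folklore] -/
def exchInv (bp : ↥solidTorus) : (𝕊 1) × (𝔼 2) :=
  (conjCircle (bp : (𝔼 2) × (𝕊 1)).2, rot (circleMul (bp : (𝔼 2) × (𝕊 1)).2 (bp : (𝔼 2) × (𝕊 1)).2)
    (bp : (𝔼 2) × (𝕊 1)).1)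

/-- The formula of the exchange map in coordinates: `G (u, w) = (u² · w, ū)`. [folklore] -/
theorem coe_exch {q : (𝕊 1) × (𝔼 2)} (hq : ‖q.2‖ < 1) :
    (exch q : (𝔼 2) × (𝕊 1)) = (rot (circleMul q.1 q.1) q.2, conjCircle q.1) := by
  rw [exch, dif_pos hq]

/-- `exchInv` is a left inverse of `exch` on the unit disc bundle. [folklore] -/
theorem exchInv_exch {q : (𝕊 1) × (𝔼 2)} (hq : ‖q.2‖ < 1) : exchInv (exch q) = q := by
  ext1
  · simp [exchInv, coe_exch hq]
  · simp only [exchInv, coe_exch hq, rot_rot, ← conjCircle_circleMul, circleMul_conjCircle_self,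
      rot_circlePoint_zero]

/-- `exchInv` takes values in the unit disc bundle. [folklore] -/
theorem norm_exchInv_snd (bp : ↥solidTorus) : ‖(exchInv bp).2‖ < 1 := by
  rw [exchInv, norm_rot]; exact (mem_solidTorus_iff _).1 bp.2

/-- `exchInv` is a right inverse of `exch` on the open solid torus. [folklore] -/
theorem exch_exchInv (bp : ↥solidTorus) : exch (exchInv bp) = bp := by
  apply Subtype.ext
  rw [coe_exch (norm_exchInv_snd bp)]
  ext1
  · simp only [exchInv, rot_rot]
    rw [← conjCircle_circleMul, circleMul_conjCircle_self, rot_circlePoint_zero]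
  · simp [exchInv]

/-- The exchange is smooth on the unit disc bundle. [folklore] -/
theorem contMDiffOn_exch : ContMDiffOn ((𝓡 1).prod 𝓘(ℝ, 𝔼 2)) (𝓘(ℝ, 𝔼 2).prod (𝓡 1)) ∞
    (fun q : (𝕊 1) × (𝔼 2) ↦ exch q) {q | ‖q.2‖ < 1} := by
  have ho : IsOpen {q : (𝕊 1) × (𝔼 2) | ‖q.2‖ < 1} := isOpen_lt (continuous_norm.comp continuous_snd) continuous_const
  have hu : ContMDiff ((𝓡 1).prod 𝓘(ℝ, 𝔼 2)) (𝓡 1) ∞ (fun q : (𝕊 1) × (𝔼 2) ↦ q.1) := contMDiff_fst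
  have hw : ContMDiff ((𝓡 1).prod 𝓘(ℝ, 𝔼 2)) 𝓘(ℝ, 𝔼 2) ∞ (fun q : (𝕊 1) × (𝔼 2) ↦ q.2) := contMDiff_snd
  have hF : ContMDiff ((𝓡 1).prod 𝓘(ℝ, 𝔼 2)) (𝓘(ℝ, 𝔼 2).prod (𝓡 1)) ∞
      fun q : (𝕊 1) × (𝔼 2) ↦ ((rot (circleMul q.1 q.1) q.2, conjCircle q.1) : (𝔼 2) × (𝕊 1)) :=
    (contMDiff_rot.comp ((contMDiff_circleMul.comp (hu.prodMk hu)).prodMk hw)).prodMk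
      (contMDiff_conjCircle.comp hu)
  intro q hq
  rw [← ContMDiffWithinAt.subtypeVal_comp_iff]
  have hev : (Subtype.val ∘ fun q : (𝕊 1) × (𝔼 2) ↦ exch q) =ᶠ[𝓝 q]
      fun q ↦ ((rot (circleMul q.1 q.1) q.2, conjCircle q.1) : (𝔼 2) × (𝕊 1)) := by
    filter_upwards [ho.mem_nhds hq] with q' hq'
    exact coe_exch hq'
  exact (hF.contMDiffAt.congr_of_eventuallyEq hev).contMDiffWithinAt

/-- The inverse exchange is smooth. [folklore] -/
theorem contMDiff_exchInv : ContMDiff (𝓘(ℝ, 𝔼 2).prod (𝓡 1)) ((𝓡 1).prod 𝓘(ℝ, 𝔼 2)) ∞ exchInv := by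
  have h1 : ContMDiff (𝓘(ℝ, 𝔼 2).prod (𝓡 1)) (𝓡 1) ∞ fun bp : ↥solidTorus ↦ (bp : (𝔼 2) × (𝕊 1)).2 :=
    contMDiff_snd.comp contMDiff_subtype_val
  have h2 : ContMDiff (𝓘(ℝ, 𝔼 2).prod (𝓡 1)) 𝓘(ℝ, 𝔼 2) ∞ fun bp : ↥solidTorus ↦ (bp : (𝔼 2) × (𝕊 1)).1 :=
    contMDiff_fst.comp contMDiff_subtype_val
  exact (contMDiff_conjCircle.comp h1).prodMk
    (contMDiff_rot.comp ((contMDiff_circleMul.comp (h1.prodMk h1)).prodMk h2))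

/-- The open solid torus is nonempty. [folklore] -/
instance nonempty_solidTorus : Nonempty ↥solidTorus := ⟨basePtB⟩

/-- The inverse of `inr` as a partial homeomorphism. [folklore] -/
def inrInv : ν.Surgered → ↥solidTorus :=
  (ν.glueData.isOpenEmbedding_inr.toOpenPartialHomeomorph ν.glueData.inr).symm

omit [IsManifold (𝓡 3) ∞ X] in
/-- `inrInv` is a left inverse of `inr`. [folklore] -/
theorem inrInv_inr (bp : ↥solidTorus) : ν.inrInv (ν.glueData.inr bp) = bp :=
  ν.glueData.isOpenEmbedding_inr.toOpenPartialHomeomorph_left_inv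

omit [IsManifold (𝓡 3) ∞ X] in
/-- `inrInv` is a right inverse of `inr` on the range of `inr`. [folklore] -/
theorem inr_inrInv {p : ν.Surgered} (hp : p ∈ range ν.glueData.inr) : ν.glueData.inr (ν.inrInv p) = p := by
  unfold inrInv
  exact Topology.IsOpenEmbedding.toOpenPartialHomeomorph_right_inv ν.glueData.inr
    ν.glueData.isOpenEmbedding_inr hp

/-- `inrInv` is `C^∞` on the range of `inr` (inverse of an open smooth embedding). [folklore] -/
theorem contMDiffOn_inrInv : ContMDiffOn 𝓘(ℝ, 𝔼 3) (𝓘(ℝ, 𝔼 2).prod (𝓡 1)) ∞ ν.inrInv (range ν.glueData.inr) :=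
  contMDiffOn_symm_of_isSmoothEmbedding ν.glueData.isSmoothEmbedding_inr ν.glueData.isOpenEmbedding_inr

/-- **The re-gluing partial diffeomorphism near the core**: `ν (u, w) ↦ inr (u² · w, ū)` from the
open unit tube `ν (𝕊 1 × B²)` of `X` onto the new solid torus `inr (D̊² × 𝕊 1)` of the surgered
manifold; it extends the identification `inl ∘ Ψ⁻¹` of the punctured tube across the core. [folklore] -/
def coreHomeo : OpenPartialHomeomorph X ν.Surgered where
  toFun x := ν.glueData.inr (exch (ν.toHomeo.symm x))
  invFun p := ν.toFun (exchInv (ν.inrInv p))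
  source := ν.toFun '' {q | ‖q.2‖ < 1}
  target := range ν.glueData.inr
  map_source' := by
    rintro _ ⟨q, hq, rfl⟩; exact mem_range_self _
  map_target' := by
    rintro _ ⟨bp, rfl⟩
    refine ⟨exchInv (ν.inrInv (ν.glueData.inr bp)), ?_, rfl⟩
    exact norm_exchInv_snd _
  left_inv' := by
    rintro _ ⟨q, hq, rfl⟩
    simp only [toHomeo_symm_apply, inrInv_inr, exchInv_exch hq]
  right_inv' := by
    rintro _ ⟨bp, rfl⟩
    simp only [toHomeo_symm_apply, inrInv_inr, exch_exchInv]
  open_source := ν.isOpenEmbedding.isOpenMap _ (isOpen_lt (continuous_norm.comp continuous_snd) continuous_const)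
  open_target := ν.glueData.isOpen_range_inr
  continuousOn_toFun := by
    refine (ν.glueData.contMDiff_inr.comp_contMDiffOn (contMDiffOn_exch.comp
      (ν.contMDiffOn_toHomeo_symm.mono (image_subset_range _ _)) ?_)).continuousOn
    rintro _ ⟨q, hq, rfl⟩
    simpa [toHomeo_symm_apply] using hq
  continuousOn_invFun :=
    (ν.contMDiff.comp_contMDiffOn (contMDiff_exchInv.comp_contMDiffOn ν.contMDiffOn_inrInv)).continuousOn

/-- The source of `coreHomeo` is the image of the unit disc bundle under the tube. [folklore] -/
theorem coreHomeo_source : ν.coreHomeo.source = ν.toFun '' {q | ‖q.2‖ < 1} := rfl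
/-- The target of `coreHomeo` is the range of `inr`. [folklore] -/
theorem coreHomeo_target : ν.coreHomeo.target = range ν.glueData.inr := rfl

/-- `coreHomeo` on a tube point: `ν (u, w) ↦ inr (u² · w, ū)`. [folklore] -/
theorem coreHomeo_apply_toFun {q : (𝕊 1) × (𝔼 2)} (hq : ‖q.2‖ < 1) :
    ν.coreHomeo (ν.toFun q) = ν.glueData.inr ⟨(rot (circleMul q.1 q.1) q.2, conjCircle q.1),
      by rwa [mem_solidTorus_iff, norm_rot]⟩ := by
  show ν.glueData.inr (exch (ν.toHomeo.symm (ν.toFun q))) = _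
  rw [toHomeo_symm_apply]
  congr 1
  exact Subtype.ext (coe_exch hq)

/-- `coreHomeo` is `C^∞` on its source. [folklore] -/
theorem contMDiffOn_coreHomeo : ContMDiffOn 𝓘(ℝ, 𝔼 3) 𝓘(ℝ, 𝔼 3) ∞ ν.coreHomeo ν.coreHomeo.source := by
  refine ν.glueData.contMDiff_inr.comp_contMDiffOn (contMDiffOn_exch.comp
    (ν.contMDiffOn_toHomeo_symm.mono (image_subset_range _ _)) ?_)
  rintro _ ⟨q, hq, rfl⟩
  simpa [toHomeo_symm_apply] using hq

/-- The inverse of `coreHomeo` is `C^∞` on its source. [folklore] -/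
theorem contMDiffOn_coreHomeo_symm :
    ContMDiffOn 𝓘(ℝ, 𝔼 3) 𝓘(ℝ, 𝔼 3) ∞ ν.coreHomeo.symm ν.coreHomeo.target :=
  ν.contMDiff.comp_contMDiffOn (contMDiff_exchInv.comp_contMDiffOn ν.contMDiffOn_inrInv)

end TubeNbhd

end CoreHomeo

/-! ### The twisted embedding of `M` into the surgered manifold -/

namespace LickorishTwist

section Twisted

variable {M : Type u} [TopologicalSpace M] [ChartedSpace (EuclideanHalfSpace 3) M]
  {b : BoundaryData (𝓡∂ 3) M (𝓡 2)} (c : b.Collar) (e : AnnulusChart (𝓡 2) b.carrier) {d : ℝ}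
  {N : Type u} [TopologicalSpace N] [ChartedSpace (EuclideanHalfSpace 3) N]
  {bN : BoundaryData (𝓡∂ 3) N (𝓡 2)} {φ : b.carrier → bN.carrier}
  {P : Type v} [TopologicalSpace P] [ChartedSpace (𝔼 3) P] {jM : M → P} {jN : N → P}

/-- The circle parameter `u` of a point `c (e (u, 1/2), d)` of the core circle. [folklore] -/
def coreParam {m : M} (hm : m ∈ c.twistCore e d) : 𝕊 1 := Classical.choose hm

/-- The core parameter of a core point `m = c (e (u, 1/2), d)` is `u`. [folklore] -/
theorem coreParam_spec {m : M} (hm : m ∈ c.twistCore e d) :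
    c (e (coreParam c e hm, 1 / 2), Set.projIcc 0 1 zero_le_one d) = m :=
  Classical.choose_spec hm

/-- The parametrisation of the core circle is injective. [folklore] -/
theorem core_injective : Injective fun u : 𝕊 1 ↦ c (e (u, 1 / 2), Set.projIcc 0 1 zero_le_one d) := by
  intro u u' huu'
  have h1 := congrArg Prod.fst (c.injective huu')
  exact congrArg Prod.fst (e.injective h1)

/-- The core parameter of the zero section point `tubeM (u, 0)` is `u`. [folklore] -/
theorem coreParam_tubeM_zero (u : 𝕊 1) (hm : tubeM c e d (u, 0) ∈ c.twistCore e d) :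
    coreParam c e hm = u :=
  core_injective c e ((coreParam_spec c e hm).trans (tubeM_zero c e u))

variable (h : IsBoundaryGluingWith b bN φ (𝓡 3) jM jN) (hd0 : 0 < d) (hd : d ≤ 1 / 3)

include h hd0 hd in
/-- Off the core circle, `jM ∘ Ψ⁻¹` misses the image of the core circle. [folklore] -/
theorem apply_twistExtensionInv_not_mem_range {m : M} (hm : m ∉ c.twistCore e d) :
    jM (c.twistExtensionInv e d m) ∉ range fun u : 𝕊 1 ↦ jM (tubeM c e d (u, 0)) := by
  rintro ⟨u, hu⟩
  have h1 : tubeM c e d (u, 0) = c.twistExtensionInv e d m := h.injective_left hu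
  exact c.twistExtensionInv_not_mem_twistCore e hd0 (by linarith) hm (h1 ▸ tubeM_zero_mem_twistCore c e u)

variable [T2Space P] [IsManifold (𝓡 3) ∞ P] [CompactSpace N]

open Classical in
/-- The map `M → P ∖ jM (core)` underlying the twisted embedding off the core: `jM ∘ Ψ⁻¹`
(junk on the core circle). [folklore] -/
def offCore (m : M) : ↥(tube c e h hd0 hd).complement :=
  if hm : m ∈ c.twistCore e d then (tube c e h hd0 hd).basePtA
  else ⟨jM (c.twistExtensionInv e d m), apply_twistExtensionInv_not_mem_range c e h hd0 hd hm⟩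

/-- Off the core circle, `offCore m` is `jM (Ψ⁻¹ m)` as a point of `P`. [folklore] -/
theorem coe_offCore {m : M} (hm : m ∉ c.twistCore e d) :
    (offCore c e h hd0 hd m : P) = jM (c.twistExtensionInv e d m) := by
  rw [offCore, dif_neg hm]

open Classical in
/-- **The twisted embedding** `jM'' : M → P'` of `M` into the surgered manifold
`P' = (P ∖ jM (core)) ∪ (D̊² × 𝕊 1)`: `inl ∘ jM ∘ Ψ⁻¹` off the core circle (the collar twist
absorbed), and the core circle parametrised onto the core of the new solid torus, `u ↦ inr (0, ū)`.
[cite: LickorishAnnals1962, proof of Thm. 2 (p. 539, Fig. 11)] -/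
def twistedEmb (m : M) : (tube c e h hd0 hd).Surgered :=
  if hm : m ∈ c.twistCore e d then
    (tube c e h hd0 hd).glueData.inr ⟨((0 : 𝔼 2), conjCircle (coreParam c e hm)), by simp [mem_solidTorus_iff]⟩
  else (tube c e h hd0 hd).glueData.inl (offCore c e h hd0 hd m)

/-- Off the core circle the twisted embedding is `inl ∘ jM ∘ Ψ⁻¹`. [folklore] -/
theorem twistedEmb_of_not_mem {m : M} (hm : m ∉ c.twistCore e d) :
    twistedEmb c e h hd0 hd m = (tube c e h hd0 hd).glueData.inl (offCore c e h hd0 hd m) := by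
  rw [twistedEmb, dif_neg hm]

/-- On the core circle the twisted embedding is `u ↦ inr (0, ū)`. [folklore] -/
theorem twistedEmb_of_mem {m : M} (hm : m ∈ c.twistCore e d) :
    twistedEmb c e h hd0 hd m = (tube c e h hd0 hd).glueData.inr
      ⟨((0 : 𝔼 2), conjCircle (coreParam c e hm)), by simp [mem_solidTorus_iff]⟩ := by
  rw [twistedEmb, dif_pos hm]

/-- **The twisted embedding on the tube**: `jM'' (tube (u, w)) = inr (u² · w, ū)` for `‖w‖ < 1` —
the identification `inl ∘ jM ∘ Ψ⁻¹` of the punctured tube extends smoothly across the core. [folklore] -/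
theorem twistedEmb_tubeM {q : (𝕊 1) × (𝔼 2)} (hq : ‖q.2‖ < 1) :
    twistedEmb c e h hd0 hd (tubeM c e d q) = (tube c e h hd0 hd).glueData.inr
      ⟨(rot (circleMul q.1 q.1) q.2, conjCircle q.1), by rwa [mem_solidTorus_iff, norm_rot]⟩ := by
  set ν := tube c e h hd0 hd with hν
  by_cases hq0 : q.2 = 0
  · obtain ⟨u, w⟩ := q
    simp only at hq0
    subst hq0
    rw [twistedEmb_of_mem c e h hd0 hd (tubeM_zero_mem_twistCore c e u)]
    congr 2
    simp only [rot_zero, Prod.mk.injEq, true_and]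
    rw [coreParam_tubeM_zero]
  · have hm : tubeM c e d q ∉ c.twistCore e d := fun h' ↦ hq0 ((tubeM_mem_twistCore_iff c e hd0 hd q).1 h')
    rw [twistedEmb_of_not_mem c e h hd0 hd hm, SmoothGlueData.inl_eq_inr_iff]
    set ŵ := radialProjection (spherePt 1) q.2 with hŵ
    set q₁ : (𝕊 1) × (𝔼 2) := (circleMul (circleMul q.1 ŵ) q.1, rot (conjCircle (circleMul q.1 ŵ)) q.2) with hq₁
    have hΨ : c.twistExtensionInv e d (tubeM c e d q) = tubeM c e d q₁ := twistExtensionInv_tubeM c e hd0 hd hq0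
    have hw₁ : q₁.2 ≠ 0 := by rw [hq₁]; simpa [rot_eq_zero_iff] using hq0
    have hw₁' : ‖q₁.2‖ < 1 := by rw [hq₁]; simpa using hq
    have ha : (offCore c e h hd0 hd (tubeM c e d q) : P) = ν.toFun q₁ := by
      rw [coe_offCore c e h hd0 hd hm, hΨ]; rfl
    constructor
    · rw [TubeNbhd.glueData_glue, TubeNbhd.glue_source, mem_setOf_eq, ha, TubeNbhd.apply_mem_puncturedTube_iff]
      exact ⟨hw₁, hw₁'⟩
    · rw [TubeNbhd.glueData_glue, TubeNbhd.glue_apply]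
      apply Subtype.ext
      have hfwd : (ν.fwdB (offCore c e h hd0 hd (tubeM c e d q)) : (𝔼 2) × (𝕊 1)) = TubeNbhd.polar q₁ := by
        have : offCore c e h hd0 hd (tubeM c e d q) = ⟨ν.toFun q₁, by
            rw [TubeNbhd.mem_complement_iff, ν.apply_mem_range_iff]; exact hw₁⟩ := Subtype.ext ha
        rw [this, ν.coe_fwdB_apply hw₁']
      rw [hfwd, TubeNbhd.polar]
      ext1
      · -- `‖w₁‖ • ((u ŵ) u) = (u u) · w`
        simp only [hq₁, norm_rot]
        rw [show circleMul (circleMul q.1 ŵ) q.1 = circleMul (circleMul q.1 q.1) ŵ by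
          rw [circleMul_comm (circleMul q.1 ŵ) q.1, ← circleMul_assoc], coe_circleMul_eq_rot,
          ← rot_smul, norm_smul_coe_radialProjection]
      · -- `w₁/‖w₁‖ = ū`
        simp only [hq₁]
        rw [radialProjection_rot _ _ hq0, ← hŵ, conjCircle_circleMul, circleMul_assoc,
          circleMul_conjCircle_self, circleMul_circlePoint_zero_right]

/-- The twisted embedding on the unit tube is the re-gluing partial diffeomorphism after `jM`. [folklore] -/
theorem twistedEmb_eq_coreHomeo {q : (𝕊 1) × (𝔼 2)} (hq : ‖q.2‖ < 1) :
    twistedEmb c e h hd0 hd (tubeM c e d q) = (tube c e h hd0 hd).coreHomeo (jM (tubeM c e d q)) := by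
  rw [twistedEmb_tubeM c e h hd0 hd hq]
  exact ((tube c e h hd0 hd).coreHomeo_apply_toFun hq).symm

/-! #### The twisted embedding is a smooth embedding -/

/-- The twisted embedding is injective. [folklore] -/
theorem twistedEmb_injective : Injective (twistedEmb c e h hd0 hd) := by
  set ν := tube c e h hd0 hd with hν
  intro m₁ m₂ hm
  by_cases h₁ : m₁ ∈ c.twistCore e d <;> by_cases h₂ : m₂ ∈ c.twistCore e d
  · rw [twistedEmb_of_mem c e h hd0 hd h₁, twistedEmb_of_mem c e h hd0 hd h₂] at hm
    have := congrArg (fun bp : ↥solidTorus ↦ (bp : (𝔼 2) × (𝕊 1)).2) (ν.glueData.inr_injective hm)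
    simp only at this
    have hu : coreParam c e h₁ = coreParam c e h₂ := by simpa using congrArg conjCircle this
    rw [← coreParam_spec c e h₁, ← coreParam_spec c e h₂, hu]
  · exfalso
    rw [twistedEmb_of_mem c e h hd0 hd h₁, twistedEmb_of_not_mem c e h hd0 hd h₂] at hm
    obtain ⟨ha, hab⟩ := ν.glueData.inl_eq_inr_iff.1 hm.symm
    have ht := ν.glueData.glue.map_source ha
    rw [hab, TubeNbhd.glueData_glue, TubeNbhd.glue_target] at ht
    exact ht rfl
  · exfalso
    rw [twistedEmb_of_not_mem c e h hd0 hd h₁, twistedEmb_of_mem c e h hd0 hd h₂] at hm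
    obtain ⟨ha, hab⟩ := ν.glueData.inl_eq_inr_iff.1 hm
    have ht := ν.glueData.glue.map_source ha
    rw [hab, TubeNbhd.glueData_glue, TubeNbhd.glue_target] at ht
    exact ht rfl
  · rw [twistedEmb_of_not_mem c e h hd0 hd h₁, twistedEmb_of_not_mem c e h hd0 hd h₂] at hm
    have := congrArg (fun a : ↥ν.complement ↦ (a : P)) (ν.glueData.inl_injective hm)
    simp only [coe_offCore c e h hd0 hd h₁, coe_offCore c e h hd0 hd h₂] at this
    exact c.twistExtensionInv_injective e d (h.injective_left this)

variable [T2Space M] [IsManifold (𝓡∂ 3) ∞ M] [CompactSpace b.carrier] [T2Space b.carrier]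

/-- **The twisted embedding is an immersion at every point off the core circle**: there it is
`inl ∘ jM ∘ Ψ⁻¹` with `Ψ⁻¹` a partial diffeomorphism of `M`, `jM` an immersion and `inl` an open
smooth embedding. [folklore] -/
theorem isImmersionAtOfComplement_twistedEmb_of_not_mem {F : Type*} [NormedAddCommGroup F]
    [NormedSpace ℝ F] (hF : Manifold.IsImmersionOfComplement F (𝓡∂ 3) (𝓡 3) ∞ jM)
    {m : M} (hm : m ∉ c.twistCore e d) :
    Manifold.IsImmersionAtOfComplement F (𝓡∂ 3) 𝓘(ℝ, 𝔼 3) ∞ (twistedEmb c e h hd0 hd) m := by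
  set ν := tube c e h hd0 hd with hν
  set Φ := (c.twistExtension e hd0 hd).symm with hΦ
  -- `jM ∘ Ψ⁻¹` is an immersion at `m`
  have h1 : Manifold.IsImmersionAtOfComplement F (𝓡∂ 3) (𝓡 3) ∞ (jM ∘ Φ) m :=
    (hF (Φ m)).comp_openPartialHomeomorph Φ (c.contMDiffOn_twistExtension_symm e hd0 hd)
      (by rw [hΦ, OpenPartialHomeomorph.symm_symm]; exact c.contMDiffOn_twistExtension e hd0 hd) hm
  -- hence so is the underlying map of `offCore`, which agrees with it near `m`
  have hopen : IsOpen (c.twistCore e d)ᶜ := (c.isClosed_twistCore e).isOpen_compl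
  have h2 : Manifold.IsImmersionAtOfComplement F (𝓡∂ 3) (𝓡 3) ∞ (fun m' ↦ (offCore c e h hd0 hd m' : P)) m := by
    refine h1.congr_of_eventuallyEq (Filter.eventuallyEq_of_mem (hopen.mem_nhds hm) fun m' hm' ↦ ?_)
    exact (coe_offCore c e h hd0 hd hm').symm
  have h3 : Manifold.IsImmersionAtOfComplement F (𝓡∂ 3) (𝓡 3) ∞ (offCore c e h hd0 hd) m := by
    have := h2.codRestrict_opens ν.complement (fun y ↦ (offCore c e h hd0 hd y).2)
    exact this
  have h4 := ν.glueData.isImmersionAtOfComplement_inl_comp h3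
  refine h4.congr_of_eventuallyEq (Filter.eventuallyEq_of_mem (hopen.mem_nhds hm) fun m' hm' ↦ ?_)
  exact (twistedEmb_of_not_mem c e h hd0 hd hm').symm

omit [T2Space M] [IsManifold (𝓡∂ 3) ∞ M] [CompactSpace b.carrier] [T2Space b.carrier] in
/-- The preimage of the open unit tube is an open neighbourhood of the core circle in `M` on which
the twisted embedding is the re-gluing partial diffeomorphism after `jM`. [folklore] -/
theorem twistedEmb_eq_coreHomeo_of_mem {m : M} (hm : jM m ∈ (tube c e h hd0 hd).coreHomeo.source) :
    twistedEmb c e h hd0 hd m = (tube c e h hd0 hd).coreHomeo (jM m) := by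
  obtain ⟨q, hq, hqm⟩ := hm
  have : m = tubeM c e d q := h.injective_left (hqm.symm.trans rfl)
  subst this
  exact twistedEmb_eq_coreHomeo c e h hd0 hd hq

omit [CompactSpace b.carrier] [T2Space b.carrier] [T2Space M] in
/-- **The twisted embedding is an immersion at every point of the core circle**: near it, it is
the re-gluing partial diffeomorphism `coreHomeo` after the immersion `jM`. [folklore] -/
theorem isImmersionAtOfComplement_twistedEmb_of_mem {F : Type*} [NormedAddCommGroup F]
    [NormedSpace ℝ F] (hF : Manifold.IsImmersionOfComplement F (𝓡∂ 3) (𝓡 3) ∞ jM)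
    {m : M} (hm : m ∈ c.twistCore e d) :
    Manifold.IsImmersionAtOfComplement F (𝓡∂ 3) 𝓘(ℝ, 𝔼 3) ∞ (twistedEmb c e h hd0 hd) m := by
  set ν := tube c e h hd0 hd with hν
  obtain ⟨u, rfl⟩ := hm
  have hm' : jM (c (e (u, 1 / 2), Set.projIcc 0 1 zero_le_one d)) ∈ ν.coreHomeo.source := by
    rw [← tubeM_zero]
    exact ⟨(u, 0), by simp, rfl⟩
  have h1 := (hF _).openPartialHomeomorph_comp ν.coreHomeo ν.contMDiffOn_coreHomeo ν.contMDiffOn_coreHomeo_symm hm'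
  have hopen : IsOpen (jM ⁻¹' ν.coreHomeo.source) := ν.coreHomeo.open_source.preimage h.continuous_left
  refine h1.congr_of_eventuallyEq (Filter.eventuallyEq_of_mem (hopen.mem_nhds hm') fun m' hm'' ↦ ?_)
  exact (twistedEmb_eq_coreHomeo_of_mem c e h hd0 hd hm'').symm

/-- **The twisted embedding is an immersion** (with the complement of `jM`). [folklore] -/
theorem isImmersion_twistedEmb : Manifold.IsImmersion (𝓡∂ 3) 𝓘(ℝ, 𝔼 3) ∞ (twistedEmb c e h hd0 hd) := by
  obtain ⟨F, _, _, hF⟩ := h.isSmoothEmbedding_left.isImmersion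
  refine Manifold.IsImmersionOfComplement.isImmersion (F := F) fun m ↦ ?_
  by_cases hm : m ∈ c.twistCore e d
  · exact isImmersionAtOfComplement_twistedEmb_of_mem c e h hd0 hd hF hm
  · exact isImmersionAtOfComplement_twistedEmb_of_not_mem c e h hd0 hd hF hm

/-- The twisted embedding is continuous. [folklore] -/
theorem continuous_twistedEmb : Continuous (twistedEmb c e h hd0 hd) :=
  continuous_iff_continuousAt.2 fun m ↦ ((isImmersion_twistedEmb c e h hd0 hd).isImmersionAt m).continuousAt

variable [CompactSpace M]

/-- **The twisted embedding is a smooth embedding** of `M` into the surgered manifold. [folklore] -/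
theorem isSmoothEmbedding_twistedEmb :
    Manifold.IsSmoothEmbedding (𝓡∂ 3) 𝓘(ℝ, 𝔼 3) ∞ (twistedEmb c e h hd0 hd) :=
  ⟨isImmersion_twistedEmb c e h hd0 hd,
    ((continuous_twistedEmb c e h hd0 hd).isClosedEmbedding (twistedEmb_injective c e h hd0 hd)).isEmbedding⟩

/-! #### The other piece, the cover and the seam -/

omit [T2Space M] [IsManifold (𝓡∂ 3) ∞ M] [CompactSpace b.carrier] [T2Space b.carrier] [CompactSpace M]
  [T2Space P] [IsManifold (𝓡 3) ∞ P] [CompactSpace N] in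
include h hd0 hd in
/-- The image of `N` misses the image of the core circle (an interior circle of `M`). [folklore] -/
theorem apply_right_not_mem_range (y : N) : jN y ∉ range fun u : 𝕊 1 ↦ jM (tubeM c e d (u, 0)) := by
  rintro ⟨u, hu⟩
  exact h.apply_not_mem_range_right (tubeM_mem_interior c e hd0 hd (u, 0)) ⟨y, hu.symm⟩

/-- **The embedding of `N` into the surgered manifold**: `inl ∘ jN`. [folklore] -/
def rightEmb (y : N) : (tube c e h hd0 hd).Surgered :=
  (tube c e h hd0 hd).glueData.inl ⟨jN y, apply_right_not_mem_range c e h hd0 hd y⟩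

omit [T2Space M] [IsManifold (𝓡∂ 3) ∞ M] [CompactSpace b.carrier] [T2Space b.carrier] [CompactSpace M] in
/-- The right piece of the surgered gluing is `inl ∘ jN`. [folklore] -/
theorem rightEmb_apply (y : N) : rightEmb c e h hd0 hd y =
    (tube c e h hd0 hd).glueData.inl ⟨jN y, apply_right_not_mem_range c e h hd0 hd y⟩ := rfl

omit [T2Space M] [IsManifold (𝓡∂ 3) ∞ M] [CompactSpace b.carrier] [T2Space b.carrier] [CompactSpace M] in
/-- The embedding of `N` into the surgered manifold is a smooth embedding. [folklore] -/
theorem isSmoothEmbedding_rightEmb [IsManifold (𝓡∂ 3) ∞ N] :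
    Manifold.IsSmoothEmbedding (𝓡∂ 3) 𝓘(ℝ, 𝔼 3) ∞ (rightEmb c e h hd0 hd) := by
  set ν := tube c e h hd0 hd with hν
  have hg : Manifold.IsSmoothEmbedding (𝓡∂ 3) (𝓡 3) ∞
      fun y : N ↦ (⟨jN y, apply_right_not_mem_range c e h hd0 hd y⟩ : ↥ν.complement) := by
    obtain ⟨F, _, _, hF⟩ := h.isSmoothEmbedding_right.isImmersion
    refine ⟨Manifold.IsImmersionOfComplement.isImmersion (F := F) fun y ↦ ?_,
      Topology.IsEmbedding.of_comp (h.continuous_right.subtype_mk _) continuous_subtype_val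
        h.isSmoothEmbedding_right.isEmbedding⟩
    exact (hF y).codRestrict_opens ν.complement (fun y ↦ apply_right_not_mem_range c e h hd0 hd y)
  exact ν.glueData.isSmoothEmbedding_inl_comp hg

omit [T2Space M] [IsManifold (𝓡∂ 3) ∞ M] [CompactSpace b.carrier] [T2Space b.carrier] [CompactSpace M] in
/-- **The two pieces cover the surgered manifold.** [folklore] -/
theorem range_twistedEmb_union_range_rightEmb :
    range (twistedEmb c e h hd0 hd) ∪ range (rightEmb c e h hd0 hd) = univ := by
  set ν := tube c e h hd0 hd with hν
  refine eq_univ_of_forall fun p ↦ ?_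
  rcases ν.glueData.exists_inl_or_inr p with ⟨a, rfl⟩ | ⟨bp, rfl⟩
  · -- a point of `P` off the core circle: in `jN (N)` or of the form `jM m`, `m` off the core
    obtain ⟨x, hx⟩ := a
    rcases (h.range_union_range ▸ mem_univ x : x ∈ range jM ∪ range jN) with ⟨m, rfl⟩ | ⟨y, rfl⟩
    · left
      have hm : m ∉ c.twistCore e d := by
        rintro ⟨u, rfl⟩
        exact hx ⟨u, by simp only [tubeM_zero]⟩
      have hm₀ : c.twistExtensionFun e d m ∉ c.twistCore e d :=
        c.twistExtensionFun_not_mem_twistCore e hd0 (by linarith) hm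
      refine ⟨c.twistExtensionFun e d m, ?_⟩
      rw [twistedEmb_of_not_mem c e h hd0 hd hm₀]
      congr 1
      apply Subtype.ext
      rw [coe_offCore c e h hd0 hd hm₀, c.twistExtensionInv_twistExtensionFun]
    · right; exact ⟨y, rfl⟩
  · left
    refine ⟨tubeM c e d (TubeNbhd.exchInv bp), ?_⟩
    rw [twistedEmb_tubeM c e h hd0 hd (TubeNbhd.norm_exchInv_snd bp)]
    congr 1
    rw [← TubeNbhd.exch_exchInv bp]
    exact Subtype.ext (by rw [TubeNbhd.coe_exch (TubeNbhd.norm_exchInv_snd bp)]; rw [TubeNbhd.exch_exchInv])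

omit [T2Space M] [IsManifold (𝓡∂ 3) ∞ M] [CompactSpace b.carrier] [T2Space b.carrier] [CompactSpace M] in
/-- **The seam of the surgered manifold**: the twisted embedding and `inl ∘ jN` meet exactly along
`∂M`, glued by `φ` *precomposed with the Dehn twist* `untwistAt e 0` of `∂M`. [folklore] -/
theorem twistedEmb_eq_rightEmb_iff (m : M) (y : N) :
    twistedEmb c e h hd0 hd m = rightEmb c e h hd0 hd y ↔
      ∃ z, m = b.incl z ∧ y = bN.incl (φ (e.untwistAt 0 z)) := by
  set ν := tube c e h hd0 hd with hν
  constructor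
  · intro hmy
    by_cases hm : m ∈ c.twistCore e d
    · exfalso
      rw [twistedEmb_of_mem c e h hd0 hd hm, rightEmb_apply] at hmy
      obtain ⟨ha, hab⟩ := ν.glueData.inl_eq_inr_iff.1 hmy.symm
      have ht := ν.glueData.glue.map_source ha
      rw [hab, TubeNbhd.glueData_glue, TubeNbhd.glue_target] at ht
      exact ht rfl
    · rw [twistedEmb_of_not_mem c e h hd0 hd hm, rightEmb_apply] at hmy
      have := congrArg (fun a : ↥ν.complement ↦ (a : P)) (ν.glueData.inl_injective hmy)
      simp only [coe_offCore c e h hd0 hd hm] at this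
      obtain ⟨z, hz, rfl⟩ := (h.apply_eq_apply_iff _ _).1 this
      refine ⟨e.twistAt 0 z, ?_, by rw [e.untwistAt_twistAt]⟩
      have := congrArg (c.twistExtensionFun e d) hz
      rwa [c.twistExtensionFun_twistExtensionInv, c.twistExtensionFun_incl] at this
  · rintro ⟨z, rfl, rfl⟩
    have hm : b.incl z ∉ c.twistCore e d := c.incl_not_mem_twistCore e hd0 (by linarith) z
    rw [twistedEmb_of_not_mem c e h hd0 hd hm, rightEmb_apply]
    congr 1
    apply Subtype.ext
    rw [coe_offCore c e h hd0 hd hm, c.twistExtensionInv_incl, h.apply_incl]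

/-- **Lickorish's surgery realisation of a Dehn twist in the gluing map** (Lickorish, Ann. of
Math. 76 (1962), proof of Thm. 2, p. 539: a `C`-homeomorphism of `∂T₁` is performed "at the expense
of cutting a solid torus out of the interior of `T₁`, and having to sew it back differently";
Schultens, *Introduction to 3-Manifolds* (2014), Lemma 7.3.4). If `P = M ∪_φ N`
(`IsBoundaryGluingWith b bN φ (𝓡 3) jM jN`) and `e` is an annulus chart of `∂M`, then the manifold
`P'` obtained from `P` by surgery along the tube `tube c e h hd0 hd` around the core circle
`jM (c (e (𝕊 1 × {1/2}) × {d}))` (`Literature.Topology.FourManifolds.TubeNbhd.Surgered`, an open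
gluing of `P ∖ core` and `D̊² × 𝕊 1` along the surgery relation) is `M ∪_{φ ∘ τ} N` for the Dehn
twist `τ = untwistAt e 0` of `∂M` in the chart `e`, with the explicit pieces `twistedEmb` and
`rightEmb = inl ∘ jN`. [cite: LickorishAnnals1962, proof of Thm. 2 (pp. 538–540, Fig. 11)] -/
theorem isBoundaryGluingWith_twistedEmb [IsManifold (𝓡∂ 3) ∞ N] :
    IsBoundaryGluingWith b bN (φ ∘ e.untwistAt 0) 𝓘(ℝ, 𝔼 3) (twistedEmb c e h hd0 hd)
      (rightEmb c e h hd0 hd) :=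
  ⟨isSmoothEmbedding_twistedEmb c e h hd0 hd, isSmoothEmbedding_rightEmb c e h hd0 hd,
    range_twistedEmb_union_range_rightEmb c e h hd0 hd, twistedEmb_eq_rightEmb_iff c e h hd0 hd⟩

/-- **The same for a Dehn twist `τ` given with its chart** (`τ (e p) = e (dehnTwistModel p)`,
`τ = id` off the annulus, as in `Literature.Topology.FourManifolds.IsDehnTwist`): the surgered
manifold is `M ∪_{φ ∘ τ} N`. [cite: LickorishAnnals1962, proof of Thm. 2 (pp. 538–540, Fig. 11)] -/
theorem isBoundaryGluingWith_twistedEmb_of_dehnTwist [IsManifold (𝓡∂ 3) ∞ N]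
    {τ : b.carrier ≃ₘ⟮𝓡 2, 𝓡 2⟯ b.carrier} (h1 : ∀ p, τ (e p) = e (dehnTwistModel p))
    (h2 : ∀ x, x ∉ range e → τ x = x) :
    IsBoundaryGluingWith b bN (φ ∘ τ) 𝓘(ℝ, 𝔼 3) (twistedEmb c e h hd0 hd) (rightEmb c e h hd0 hd) := by
  have heq : (e.untwistAt 0 : b.carrier → b.carrier) = τ := funext fun x ↦ e.untwistAt_of_le h1 h2 (by norm_num) x
  rw [← heq]
  exact isBoundaryGluingWith_twistedEmb c e h hd0 hd

end Twisted

end LickorishTwist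

end Literature.Topology.FourManifolds
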